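import Summits.QuantumFields.YangMills.Theorems.BalabanUVNodesK2D1TelSchurQuotient
import Summits.QuantumFields.YangMills.Theorems.BalabanUVNodesK2D1TelSchurJets

/-!
# T-TEL (telescoping identity) line, helper 4 — THE SYMMETRIC CASE: one step = the `Wᵀ·M·W`-dressing of the full form by the response graph, and the
# second jet's correction is the GRAM-type bubble `2·Xᵀ·D₀⁻¹·X` of ONE dressed first-order vertex `X = B₁ᵀ + D₁W₀`

Helper for crux K2⁷ `EndpointGivenBR13SepCoPH` = stmt-QuantumFields-20543 (route `BalabanUVNodes`), seat `d1-tel-1` gen 0.  Helpers 1–3 (`…SchurQuotient` p782298,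
`…SchurJets` p782375, `…SchurJetsCurves` p782412) are stated for general (non-symmetric) block forms with independent left∕right responses `V`, `W`.  The quadratic
forms of the typed systems are SYMMETRIC (Hessians), the transport of `HessianTelescopingKKT.StepRecursion` dresses BOTH legs with the SAME weight
(`DressedMomentNormalisation.dressedEntry w 𝒯 · a b = Σ w c a · 𝒯 c e · w e b`), and the one-loop kernel's bubble is `K∘V∘V` with ONE vertex family: this file records
the symmetric specialisations in exactly that shape.  [folklore] block algebra; 0 `def`, 0 `sorry`.

* `schur_eq_transpose_graph_congruence` — `Dᵀ = D`, `D·W = −Bᵀ` ⟹ `(fromRows 1 W)ᵀ · [[A, B],[Bᵀ, D]] · (fromRows 1 W) = A − B·D⁻¹·Bᵀ`: ONE STEP = `Gᵀ·M·G` with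
  `G = [1 ; W]` the graph of the response (the literal `wᵀ 𝒯 w` dressing).
* `schur_firstJet_symm` — `S₁ = Gᵀ·M₁·G` (first jets: pure dressing, symmetric data).
* `schur_secondJet_symm` — `S₂ = Gᵀ·M₂·G − 2·Xᵀ·D₀⁻¹·X`, `X := B₁ᵀ + D₁·W₀` the dressed first-order vertex: DRESSED SECOND JET MINUS A GRAM BUBBLE through the frozen
  fluctuation resolvent (the «½·tadpole − ½·bubble» normalisation of `ExpKernelCalculus.hessKer` is this divided by 2).

HONEST FRAMING.  Textbook algebra; nothing of Bałaban's kernels asserted; the kernel-level dictionary (S3) of `Cruxes/EndpointGivenBR13SepCoPH/D1TelSignatures.lean` is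
OPEN; `D1Tel`, K2⁷, `BetaPertH` NOT proved; NOT continuum, NOT OS, NOT Clay; the Yang–Mills mass gap is NOT proved.
-/

namespace Summit.QuantumFields.YangMills.Theorems.BalabanUVNodesK2D1TelSchurSymmetric

open Matrix
open BalabanUVNodesK2D1TelSchurQuotient (schur_eq_graph_congruence)
open BalabanUVNodesK2D1TelSchurJets (schur_firstJet_eq_dressed schur_secondJet_eq_dressed_sub_bubble)

variable {𝕜 : Type*} [CommRing 𝕜]
variable {α δ : Type*} [Fintype α] [Fintype δ] [DecidableEq α] [DecidableEq δ]

omit [Fintype α] [Fintype δ] [DecidableEq δ] in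
/-- [folklore] The transpose of the response graph `[1 ; W]` is the row `[1 | Wᵀ]`. -/
theorem transpose_graph (W : Matrix δ α 𝕜) : (fromRows (1 : Matrix α α 𝕜) W)ᵀ = fromCols (1 : Matrix α α 𝕜) Wᵀ := by
  rw [transpose_fromRows, transpose_one]

/-- [folklore] **ONE STEP = `Gᵀ·M·G` (symmetric case).**  For a symmetric pivot `Dᵀ = D` and the exact response `D·W = −Bᵀ`, the congruence of the symmetric
block form `[[A, B],[Bᵀ, D]]` by the response graph `G = [1 ; W]` is the one-step effective form `A − B·D⁻¹·Bᵀ`. -/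
theorem schur_eq_transpose_graph_congruence (A : Matrix α α 𝕜) (B : Matrix α δ 𝕜) (D : Matrix δ δ 𝕜) (hD : IsUnit D.det)
    (W : Matrix δ α 𝕜) (hW : D * W = -Bᵀ) :
    (fromRows (1 : Matrix α α 𝕜) W)ᵀ * fromBlocks A B Bᵀ D * fromRows (1 : Matrix α α 𝕜) W = A - B * D⁻¹ * Bᵀ := by
  rw [transpose_graph]
  exact schur_eq_graph_congruence A B Bᵀ D hD W hW Wᵀ

omit [DecidableEq δ] in
/-- [folklore] **FIRST JET, symmetric case**: with symmetric pivot jets `D₀ᵀ = D₀`, the frozen response `D₀·W₀ = −B₀ᵀ` and the Leibniz relation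
(R1) `D₀W₁ + D₁W₀ = −B₁ᵀ`, the first jet of the effective form is the pure dressing `S₁ = A₁ + B₁W₀ + B₀W₁ = Gᵀ·M₁·G`, `G = [1 ; W₀]`. -/
theorem schur_firstJet_symm (A₁ : Matrix α α 𝕜) (B₀ B₁ : Matrix α δ 𝕜) (D₀ D₁ : Matrix δ δ 𝕜) (hD₀ : D₀ᵀ = D₀) (W₀ W₁ : Matrix δ α 𝕜)
    (hW₀ : D₀ * W₀ = -B₀ᵀ) (hW₁ : D₀ * W₁ + D₁ * W₀ = -B₁ᵀ) :
    A₁ + B₁ * W₀ + B₀ * W₁ = (fromRows (1 : Matrix α α 𝕜) W₀)ᵀ * fromBlocks A₁ B₁ B₁ᵀ D₁ * fromRows (1 : Matrix α α 𝕜) W₀ := by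
  have hV₀ : W₀ᵀ * D₀ = -B₀ := by
    have h := congrArg Matrix.transpose hW₀
    rw [transpose_mul, hD₀, transpose_neg, transpose_transpose] at h
    exact h
  rw [transpose_graph]
  exact schur_firstJet_eq_dressed A₁ B₀ B₁ B₁ᵀ D₀ D₁ W₀ᵀ W₀ W₁ hV₀ hW₁

/-- [folklore] **SECOND JET, symmetric case = DRESSED SECOND JET MINUS A GRAM BUBBLE.**  With symmetric pivot jets `D₀ᵀ = D₀`, `D₁ᵀ = D₁`, `D₀` non-degenerate,
the frozen response `D₀·W₀ = −B₀ᵀ` and the Leibniz relations (R1) `D₀W₁ + D₁W₀ = −B₁ᵀ`, (R2) `D₀W₂ + 2·D₁W₁ + D₂W₀ = −B₂ᵀ`: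
`S₂ = A₂ + B₂W₀ + 2·B₁W₁ + B₀W₂ = Gᵀ·M₂·G − 2·Xᵀ·D₀⁻¹·X` with `G = [1 ; W₀]` and the dressed first-order vertex `X = B₁ᵀ + D₁·W₀`. -/
theorem schur_secondJet_symm (A₂ : Matrix α α 𝕜) (B₀ B₁ B₂ : Matrix α δ 𝕜) (D₀ D₁ D₂ : Matrix δ δ 𝕜) (hD : IsUnit D₀.det) (hD₀ : D₀ᵀ = D₀)
    (hD₁ : D₁ᵀ = D₁) (W₀ W₁ W₂ : Matrix δ α 𝕜) (hW₀ : D₀ * W₀ = -B₀ᵀ) (hW₁ : D₀ * W₁ + D₁ * W₀ = -B₁ᵀ)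
    (hW₂ : D₀ * W₂ + 2 • (D₁ * W₁) + D₂ * W₀ = -B₂ᵀ) :
    A₂ + B₂ * W₀ + 2 • (B₁ * W₁) + B₀ * W₂
      = (fromRows (1 : Matrix α α 𝕜) W₀)ᵀ * fromBlocks A₂ B₂ B₂ᵀ D₂ * fromRows (1 : Matrix α α 𝕜) W₀
        - 2 • ((B₁ᵀ + D₁ * W₀)ᵀ * D₀⁻¹ * (B₁ᵀ + D₁ * W₀)) := by
  have hV₀ : W₀ᵀ * D₀ = -B₀ := by
    have h := congrArg Matrix.transpose hW₀
    rw [transpose_mul, hD₀, transpose_neg, transpose_transpose] at h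
    exact h
  have hX : (B₁ᵀ + D₁ * W₀)ᵀ = B₁ + W₀ᵀ * D₁ := by
    rw [transpose_add, transpose_transpose, transpose_mul, hD₁]
  rw [transpose_graph, hX]
  exact schur_secondJet_eq_dressed_sub_bubble A₂ B₀ B₁ B₂ B₁ᵀ B₂ᵀ D₀ D₁ D₂ W₀ᵀ W₀ W₁ W₂ hD hV₀ hW₁ hW₂

end Summit.QuantumFields.YangMills.Theorems.BalabanUVNodesK2D1TelSchurSymmetric
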